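import Summits.CriticalPhenomena.PercolationContinuityZ3.Theorems.FK.InfiniteVolumeDLROneEdgeCylinders
import HarnessLib

/-!
# FK-continuity transplant, FO-06/FO-10 (infinite-volume structure): DLR random-cluster measures are exactly the
# measures with the one-edge conditional probabilities (4.38) — Grimmett 2006, Prop. (4.37)(a)(b)

Registered R72 (cell INBOX l.5361, 2026-08-23); registry row FO-10b-g407; label DLR1e-C (coordinator fk-4 g140).
Cell `fk-continuity` (bschramm), FO-10b lineage (conditional one-edge energies); support file for the
FK-continuity transplant (`--supports stmt-CriticalPhenomena-4575`); builds on p205010 (kernel theorem,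
internal audit signed; external expert review pending). No named facts, no definitions, no sorries, standard
axioms. General dimension `d`, `0 ≤ p ≤ 1`, `q > 0`. Banked infinite-volume structure: the equivalence of the
one-edge form of the DLR condition with Def. (4.29), recorded as "not formalised here" in
`InfiniteVolumeOneEdgeDLRClosed.lean` (FO-06b-5) and used silently whenever a measure is shown to be a
random-cluster measure by checking single-edge conditional probabilities. Not an END-STATE dependency of the cell
(not consumed by `_r3`); it says nothing about FH / TP_FK or continuity at `p_c`.

Write `J_e = {e open}`, `K_e = {x ↔ y off e}` for a lattice edge `e = ⟨x,y⟩`, `𝒯_e` for the σ-algebra of the other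
edges (the events `{ω ∖ e ∈ H₀}`), `p' = p/(p + q(1-p))`, and (4.38) for the statement
"`P(J_e ∩ H) = p · P(H ∩ K_e) + p' · P(H ∖ K_e)` for every `e` and every `H ∈ 𝒯_e`".

* `real_cylEvent_inter_eq_setIntegral_of_oneEdge` — **(4.38) ⇒ (4.30) on cylinders**: for every finite
  measure `P` with (4.38), every finite region `Λ`, `η ⊆ E_Λ` and `H ∈ 𝒯_Λ`,
  `P({ω ∩ E_Λ = η} ∩ H) = ∫_H φ^ξ_{Λ,p,q}(η) P(dξ)` (summing the one-fibre identity of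
  `InfiniteVolumeDLROneEdgeCylinders.lean` over the finitely many fibres of `𝒯_Λ`);
* `lintegral_rcCondLaw_eq_of_forall_real_cylEvent_inter_eq`,
  `real_cylEvent_inter_eq_setIntegral_of_lintegral_rcCondLaw_eq` — the cylinder form of (4.30) for a region
  `Λ` is EQUIVALENT to the integrated DLR equation `∫ φ^ξ_{Λ,p,q}(A) P(dξ) = P(A)` for that `Λ` (the two
  directions of Georgii's Remark (1.24) for the random-cluster specification);
* `real_edgeOpen_inter_preimage_eq_of_lintegral_rcCondLaw_pair_eq` — the DLR equation for the one-edge region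
  `{x, y}` is (4.38) for `e = ⟨x,y⟩` (the one-edge kernel `rcCondProb_pair_singleton`);
* **`IsDLRRandomCluster.real_edgeOpen_inter_preimage_eq` — Prop. (4.37)(a)**: every `P ∈ R_{p,q}` satisfies
  (4.38);
* **`isDLRRandomCluster_of_oneEdge` — Prop. (4.37)(b)**: a probability measure with (4.38) belongs to
  `R_{p,q}`; `isDLRRandomCluster_iff_oneEdge` — the equivalence;
* `isDLRRandomCluster_of_pairs`, `isDLRRandomCluster_iff_pairs` — equivalently: **the DLR equation for the
  one-edge regions `{x, y}` implies (is equivalent to) the DLR equation for all finite regions.**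

Consistency remark (not re-derived here, to keep the Burton–Keane chain out of the imports): FO-06b's two routes to
the DLR property of the box limits `φ^b_{p,q}` — `IsBoxLimit.real_edgeOpen_inter_preimage_eq` (one edge,
`InfiniteVolumeOneEdgeDLRCondExp.lean`) and `IsBoxLimit.isDLRRandomCluster` (all regions,
`InfiniteVolumeDLRMeasures.lean`) — imply each other through `isDLRRandomCluster_iff_oneEdge`.

## References

* G. Grimmett, *The Random-Cluster Model*, Springer 2006: Thm. (3.1) eq. (3.3), Def. (4.29) eq. (4.30),
  Thm. (4.34)(b), Prop. (4.37)(a)(b) eq. (4.38) and proof, pp. 81–87. [Grimmett2006]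
* H.-O. Georgii, *Gibbs Measures and Phase Transitions*, 2nd ed. 2011, Def. (1.23), Rem. (1.24), Thm. (1.33).
  [Georgii2011]
-/

noncomputable section

open MeasureTheory Set Filter
open scoped Topology ENNReal

namespace Summit.CriticalPhenomena.PercolationContinuityZ3.Theorems.FK

open Literature.Probability.Percolation Literature.Probability.LatticeModels

variable {d : ℕ} {p q : ℝ} {P : Measure (BondConfig (Site d))}

/-! ### (4.38) implies the DLR equation on cylinders, for every finite region -/

section Engine

/-- **(4.38) ⇒ (4.30) on cylinders** (Grimmett 2006, Prop. (4.37)(b)): if a finite measure `P` on `Ω` has the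
one-edge conditional probabilities (4.38) for every lattice edge (`0 ≤ p ≤ 1`, `q > 0`), then for every finite
region `Λ`, every inside pattern `η ⊆ E_Λ` and every outside event `H ∈ 𝒯_Λ`,
`P({ω ∩ E_Λ = η} ∩ H) = ∫_H φ^ξ_{Λ,p,q}(η) P(dξ)`. Proof: `𝒯_Λ` is cut into the finitely many fibres on which all
connection questions "`u ↔ v` in `η' ∪ (ξ ∖ E_Λ)`?" are decided; on each fibre the kernel is constant and
`real_cylEvent_inter_eq_rcCondProb_mul_of_fibre` applies. [cite: Grimmett2006, Prop. (4.37)(b) eq. (4.38), proof p. 87] -/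
theorem real_cylEvent_inter_eq_setIntegral_of_oneEdge [IsFiniteMeasure P] (hp : p ∈ Set.Icc (0 : ℝ) 1)
    (hq : 0 < q)
    (hE : ∀ ⦃x y : Site d⦄, (zdGraph d).Adj x y → ∀ ⦃H₀ : Set (BondConfig (Site d))⦄, MeasurableSet H₀ →
      P.real ({ω | s(x, y) ∈ ω} ∩ (fun η => η \ {s(x, y)}) ⁻¹' H₀) =
        p * P.real ((fun η => η \ {s(x, y)}) ⁻¹' (H₀ ∩ openConn x y)) +
          p / (p + q * (1 - p)) * P.real ((fun η => η \ {s(x, y)}) ⁻¹' (H₀ ∩ (openConn x y)ᶜ)))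
    (Λ : Finset (Site d)) {η : Finset (Sym2 (Site d))} (hη : η ⊆ edgesIn (zdGraph d) Λ)
    {H : Set (BondConfig (Site d))} (hH : MeasurableSet[outsideEvents d Λ] H) :
    P.real (cylEvent (edgesIn (zdGraph d) Λ) η ∩ H) = ∫ ξ in H, rcCondProb p q Λ ξ η ∂P := by
  classical
  set U := edgesIn (zdGraph d) Λ with hU
  -- the connection questions, their answers (`sig`), and the fibres `sig ⁻¹' {t}`
  set I : Finset (Finset (Sym2 (Site d)) × (Site d × Site d)) := U.powerset ×ˢ (Λ ×ˢ Λ) with hI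
  set R : Finset (Sym2 (Site d)) × (Site d × Site d) → Set (BondConfig (Site d)) := fun i =>
    {ω | (openGraph ((↑i.1 : Set (Sym2 (Site d))) ∪ (ω \ ↑U))).Reachable i.2.1 i.2.2} with hR
  set sig : BondConfig (Site d) → Finset (Finset (Sym2 (Site d)) × (Site d × Site d)) := fun ω =>
    I.filter fun i => ω ∈ R i with hsig
  have hsigI : ∀ ω, sig ω ∈ I.powerset := fun ω => Finset.mem_powerset.2 (Finset.filter_subset _ _)
  have hRm : ∀ i, MeasurableSet[outsideEvents d Λ] (R i) := fun i =>
    measurableSet_setOf_reachable_union_sdiff Λ i.1 i.2.1 i.2.2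
  have hmem_sig : ∀ ω, ∀ i ∈ I, (i ∈ sig ω ↔ ω ∈ R i) := fun ω i hi => by
    simp only [hsig, Finset.mem_filter, hi, true_and]
  -- the fibres are outside events
  have hfib_m : ∀ t, MeasurableSet[outsideEvents d Λ] (sig ⁻¹' {t}) := by
    intro t
    by_cases ht : t ⊆ I
    · have hset : sig ⁻¹' {t} = ⋂ i ∈ I, {ω | ω ∈ R i ↔ i ∈ t} := by
        ext ω
        simp only [Set.mem_preimage, Set.mem_singleton_iff, Set.mem_iInter, Set.mem_setOf_eq]
        constructor
        · rintro hω i hi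
          rw [← hmem_sig ω i hi, hω]
        · intro h
          ext i
          constructor
          · intro hi
            have hiI : i ∈ I := Finset.filter_subset _ _ hi
            exact (h i hiI).1 ((hmem_sig ω i hiI).1 hi)
          · intro hit
            exact (hmem_sig ω i (ht hit)).2 ((h i (ht hit)).2 hit)
      rw [hset]
      refine Finset.measurableSet_biInter I fun i _ => ?_
      by_cases hit : i ∈ t
      · simp only [hit, iff_true]
        exact hRm i
      · simp only [hit, iff_false]
        exact (hRm i).compl
    · have hset : sig ⁻¹' {t} = ∅ := Set.eq_empty_of_forall_notMem fun ω hω =>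
        ht (hω ▸ Finset.filter_subset _ _)
      rw [hset]
      exact @MeasurableSet.empty _ (outsideEvents d Λ)
  -- two configurations in one fibre answer every connection question alike
  have hfib : ∀ t, ∀ ω ∈ sig ⁻¹' {t}, ∀ ω' ∈ sig ⁻¹' {t}, ∀ η' ⊆ U, ∀ u ∈ Λ, ∀ v ∈ Λ,
      ((openGraph ((↑η' : Set (Sym2 (Site d))) ∪ (ω \ ↑U))).Reachable u v ↔
        (openGraph ((↑η' : Set (Sym2 (Site d))) ∪ (ω' \ ↑U))).Reachable u v) := by
    intro t ω hω ω' hω' η' hη' u hu v hv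
    have hi : (η', (u, v)) ∈ I :=
      Finset.mem_product.2 ⟨Finset.mem_powerset.2 hη', Finset.mem_product.2 ⟨hu, hv⟩⟩
    have h1 := hmem_sig ω _ hi
    have h2 := hmem_sig ω' _ hi
    rw [Set.mem_preimage, Set.mem_singleton_iff] at hω hω'
    rw [hω] at h1
    rw [hω'] at h2
    exact h1.symm.trans h2
  -- cut `H` along the fibres
  have hcover : H = ⋃ t ∈ I.powerset, (H ∩ sig ⁻¹' {t}) := by
    ext ω
    simp only [Set.mem_iUnion, Set.mem_inter_iff, Set.mem_preimage, Set.mem_singleton_iff, exists_prop]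
    exact ⟨fun h => ⟨sig ω, hsigI ω, h, rfl⟩, fun ⟨_, _, h, _⟩ => h⟩
  have hdisj : Set.PairwiseDisjoint (↑I.powerset : Set (Finset (Finset (Sym2 (Site d)) × (Site d × Site d))))
      (fun t => H ∩ sig ⁻¹' {t}) := by
    intro t _ t' _ htt'
    exact Set.disjoint_left.2 fun ω h1 h2 => htt' (h1.2.symm.trans h2.2)
  have hpiece : ∀ t, MeasurableSet[outsideEvents d Λ] (H ∩ sig ⁻¹' {t}) := fun t => hH.inter (hfib_m t)
  have hpiece_m : ∀ t, MeasurableSet (H ∩ sig ⁻¹' {t}) := fun t => outsideEvents_le Λ _ (hpiece t)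
  have hL : P.real (cylEvent U η ∩ H) = ∑ t ∈ I.powerset, P.real (cylEvent U η ∩ (H ∩ sig ⁻¹' {t})) := by
    conv_lhs => rw [hcover]
    rw [Set.inter_iUnion₂]
    exact measureReal_biUnion_finset
      (fun t ht t' ht' htt' => (hdisj ht ht' htt').mono Set.inter_subset_right Set.inter_subset_right)
      fun t _ => (measurableSet_cylEvent U η).inter (hpiece_m t)
  have hRHS : ∫ ξ in H, rcCondProb p q Λ ξ η ∂P =
      ∑ t ∈ I.powerset, ∫ ξ in H ∩ sig ⁻¹' {t}, rcCondProb p q Λ ξ η ∂P := by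
    conv_lhs => rw [hcover]
    exact integral_biUnion_finset _ (fun t _ => hpiece_m t) hdisj
      fun t _ => (integrable_rcCondProb P hp hq Λ hη).integrableOn
  rw [hL, hRHS]
  refine Finset.sum_congr rfl fun t _ => ?_
  -- on one piece the kernel is a constant and the one-fibre identity applies
  rcases Set.eq_empty_or_nonempty (H ∩ sig ⁻¹' {t}) with h0 | ⟨ξ₀, hξ₀⟩
  · rw [h0, Set.inter_empty, measureReal_empty, Measure.restrict_empty, integral_zero_measure]
  · have hdec : ∀ ω ∈ H ∩ sig ⁻¹' {t}, ∀ η' ⊆ U, ∀ u ∈ Λ, ∀ v ∈ Λ,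
        ((openGraph ((↑η' : Set (Sym2 (Site d))) ∪ (ω \ ↑U))).Reachable u v ↔
          (openGraph ((↑η' : Set (Sym2 (Site d))) ∪ (ξ₀ \ ↑U))).Reachable u v) :=
      fun ω hω => hfib t ω hω.2 ξ₀ hξ₀.2
    rw [real_cylEvent_inter_eq_rcCondProb_mul_of_fibre hp hq hE Λ (hpiece t) hdec hη]
    have hconst : Set.EqOn (fun ξ => rcCondProb p q Λ ξ η) (fun _ => rcCondProb p q Λ ξ₀ η) (H ∩ sig ⁻¹' {t}) :=
      fun ω hω => rcCondProb_congr_of_forall_reachable_iff (hdec ω hω) hη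
    rw [setIntegral_congr_fun (hpiece_m t) hconst, setIntegral_const, smul_eq_mul, mul_comm]

end Engine

/-! ### The cylinder form and the integrated form of the DLR equation for one region -/

section Region

/-- **From cylinders to the integrated DLR equation for a region** (Georgii's Rem. (1.24) for the
random-cluster specification): if `P({ω ∩ E_Λ = η} ∩ H) = ∫_H φ^ξ_{Λ,p,q}(η) P(dξ)` for every `η ⊆ E_Λ` and
every `H ∈ 𝒯_Λ`, then `∫ φ^ξ_{Λ,p,q}(A) P(dξ) = P(A)` for every event `A` (decompose `A` along the cylinders over
`E_Λ`; the law `φ^ξ_Λ` charges the configuration `η ∪ (ξ ∖ E_Λ)`, which lies in `A` iff `ξ` lies in the outside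
event `{ξ : η ∪ (ξ ∖ E_Λ) ∈ A}`). [cite: Grimmett2006, Def. (4.29) eq. (4.30); Georgii2011, Rem. (1.24)] -/
theorem lintegral_rcCondLaw_eq_of_forall_real_cylEvent_inter_eq [IsFiniteMeasure P]
    (hp : p ∈ Set.Icc (0 : ℝ) 1) (hq : 0 < q) (Λ : Finset (Site d))
    (h : ∀ ⦃η : Finset (Sym2 (Site d))⦄, η ⊆ edgesIn (zdGraph d) Λ → ∀ ⦃H : Set (BondConfig (Site d))⦄,
      MeasurableSet[outsideEvents d Λ] H →
        P.real (cylEvent (edgesIn (zdGraph d) Λ) η ∩ H) = ∫ ξ in H, rcCondProb p q Λ ξ η ∂P)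
    {A : Set (BondConfig (Site d))} (hA : MeasurableSet A) :
    ∫⁻ ξ, rcCondLaw p q Λ ξ A ∂P = P A := by
  classical
  set U := edgesIn (zdGraph d) Λ with hU
  set Hη : Finset (Sym2 (Site d)) → Set (BondConfig (Site d)) := fun η =>
    (fun ξ : BondConfig (Site d) => (↑η : Set (Sym2 (Site d))) ∪ (ξ \ ↑U)) ⁻¹' A with hHη
  have hHηo : ∀ η, MeasurableSet[outsideEvents d Λ] (Hη η) := fun η =>
    measurableSet_outsideEvents_preimage_union_sdiff Λ η hA
  have hHηm : ∀ η, MeasurableSet (Hη η) := fun η => outsideEvents_le Λ _ (hHηo η)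
  have happly : ∀ ξ, rcCondLaw p q Λ ξ A =
      ∑ η ∈ U.powerset, (Hη η).indicator (fun ξ => ENNReal.ofReal (rcCondProb p q Λ ξ η)) ξ := by
    intro ξ
    rw [rcCondLaw_eq, Measure.finsetSum_apply]
    refine Finset.sum_congr rfl fun η _ => ?_
    rw [Measure.smul_apply, Measure.dirac_apply' _ hA, smul_eq_mul]
    by_cases h : ((↑η : Set (Sym2 (Site d))) ∪ (ξ \ ↑U)) ∈ A
    · rw [Set.indicator_of_mem h, Set.indicator_of_mem (show ξ ∈ Hη η from h), Pi.one_apply, mul_one]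
    · rw [Set.indicator_of_notMem h, Set.indicator_of_notMem (show ξ ∉ Hη η from h), mul_zero]
  simp_rw [happly]
  rw [lintegral_finsetSum _ fun η _ =>
    ((measurable_rcCondProb p q Λ η).ennreal_ofReal).indicator (hHηm η)]
  have hterm : ∀ η ∈ U.powerset,
      ∫⁻ ξ, (Hη η).indicator (fun ξ => ENNReal.ofReal (rcCondProb p q Λ ξ η)) ξ ∂P = P (cylEvent U η ∩ A) := by
    intro η hη
    have hη' := Finset.mem_powerset.1 hη
    rw [lintegral_indicator (hHηm η),
      ← ofReal_integral_eq_lintegral_ofReal (integrable_rcCondProb P hp hq Λ hη').integrableOn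
        (ae_of_all _ fun ξ => rcCondProb_nonneg hp hq Λ ξ η),
      ← h hη' (hHηo η), ofReal_measureReal]
    congr 1
    ext ω
    simp only [Set.mem_inter_iff, hHη, Set.mem_preimage]
    constructor
    · rintro ⟨hC, hAω⟩
      rw [coe_union_sdiff_eq_self_of_mem_cylEvent hη' hC] at hAω
      exact ⟨hC, hAω⟩
    · rintro ⟨hC, hAω⟩
      rw [← coe_union_sdiff_eq_self_of_mem_cylEvent hη' hC] at hAω
      exact ⟨hC, hAω⟩
  rw [Finset.sum_congr rfl hterm, ← measure_eq_sum_measure_cylEvent_inter P U hA]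

/-- **From the integrated DLR equation for a region to cylinders**: if `∫ φ^ξ_{Λ,p,q}(A) P(dξ) = P(A)` for every
event `A`, then `P({ω ∩ E_Λ = η} ∩ H) = ∫_H φ^ξ_{Λ,p,q}(η) P(dξ)` for every `η ⊆ E_Λ` and `H ∈ 𝒯_Λ` (take
`A = {ω ∩ E_Λ = η} ∩ H`: the law `φ^ξ_Λ` gives it mass `φ^ξ_Λ(η) · 1_H(ξ)`). [cite: Grimmett2006, Def. (4.29) eq. (4.30); Georgii2011, Rem. (1.24)] -/
theorem real_cylEvent_inter_eq_setIntegral_of_lintegral_rcCondLaw_eq [IsFiniteMeasure P]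
    (hp : p ∈ Set.Icc (0 : ℝ) 1) (hq : 0 < q) (Λ : Finset (Site d))
    (h : ∀ ⦃A : Set (BondConfig (Site d))⦄, MeasurableSet A → ∫⁻ ξ, rcCondLaw p q Λ ξ A ∂P = P A)
    {η : Finset (Sym2 (Site d))} (hη : η ⊆ edgesIn (zdGraph d) Λ) {H : Set (BondConfig (Site d))}
    (hH : MeasurableSet[outsideEvents d Λ] H) :
    P.real (cylEvent (edgesIn (zdGraph d) Λ) η ∩ H) = ∫ ξ in H, rcCondProb p q Λ ξ η ∂P := by
  classical
  set U := edgesIn (zdGraph d) Λ with hU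
  have hHm : MeasurableSet H := outsideEvents_le Λ _ hH
  have hAm : MeasurableSet (cylEvent U η ∩ H) := (measurableSet_cylEvent U η).inter hHm
  have happly : ∀ ξ, rcCondLaw p q Λ ξ (cylEvent U η ∩ H) =
      H.indicator (fun ξ => ENNReal.ofReal (rcCondProb p q Λ ξ η)) ξ := by
    intro ξ
    rw [rcCondLaw_eq, Measure.finsetSum_apply]
    rw [Finset.sum_eq_single_of_mem η (Finset.mem_powerset.2 hη)]
    · rw [Measure.smul_apply, Measure.dirac_apply' _ hAm, smul_eq_mul]
      by_cases hξ : ξ ∈ H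
      · rw [Set.indicator_of_mem hξ, Set.indicator_of_mem, Pi.one_apply, mul_one]
        exact ⟨(coe_union_sdiff_mem_cylEvent_iff hη hη ξ).2 rfl, (coe_union_sdiff_mem_iff_of_outsideEvents hη hH ξ).2 hξ⟩
      · rw [Set.indicator_of_notMem hξ, Set.indicator_of_notMem, mul_zero]
        exact fun hmem => hξ ((coe_union_sdiff_mem_iff_of_outsideEvents hη hH ξ).1 hmem.2)
    · intro η' hη' hne
      rw [Measure.smul_apply, Measure.dirac_apply' _ hAm, smul_eq_mul, Set.indicator_of_notMem, mul_zero]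
      exact fun hmem => hne ((coe_union_sdiff_mem_cylEvent_iff hη (Finset.mem_powerset.1 hη') ξ).1 hmem.1)
  have h1 := h hAm
  simp_rw [happly] at h1
  rw [lintegral_indicator hHm,
    ← ofReal_integral_eq_lintegral_ofReal (integrable_rcCondProb P hp hq Λ hη).integrableOn
      (ae_of_all _ fun ξ => rcCondProb_nonneg hp hq Λ ξ η)] at h1
  rw [measureReal_def, ← h1, ENNReal.toReal_ofReal]
  exact setIntegral_nonneg hHm fun ξ _ => rcCondProb_nonneg hp hq Λ ξ η

end Region

/-! ### Proposition (4.37): `R_{p,q}` is the set of measures with the one-edge conditional probabilities (4.38) -/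

section OneEdge

variable {x y : Site d}

/-- **The DLR equation for the one-edge region `{x, y}` is (4.38)**: if `∫ φ^ξ_{{x,y},p,q}(A) P(dξ) = P(A)` for
every event `A` (`e = ⟨x,y⟩` a lattice edge, `0 ≤ p ≤ 1`, `q > 0`), then for every measurable `H₀`,
`P({e open} ∩ {ω ∖ e ∈ H₀}) = p · P({ω ∖ e ∈ H₀ ∩ K}) + p/(p + q(1-p)) · P({ω ∖ e ∈ H₀ ∖ K})`, `K = {x ↔ y}`
(the one-edge kernel is `p · 1_{K_e} + p/(p+q(1-p)) · 1_{K_eᶜ}`, `rcCondProb_pair_singleton`).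
[cite: Grimmett2006, Def. (4.29) eq. (4.30), Prop. (4.37)(a) eq. (4.38)] -/
theorem real_edgeOpen_inter_preimage_eq_of_lintegral_rcCondLaw_pair_eq [IsFiniteMeasure P]
    (hp : p ∈ Set.Icc (0 : ℝ) 1) (hq : 0 < q) (hxy : (zdGraph d).Adj x y)
    (h : ∀ ⦃A : Set (BondConfig (Site d))⦄, MeasurableSet A → ∫⁻ ξ, rcCondLaw p q {x, y} ξ A ∂P = P A)
    {H₀ : Set (BondConfig (Site d))} (hH₀ : MeasurableSet H₀) :
    P.real ({ω | s(x, y) ∈ ω} ∩ (fun η => η \ {s(x, y)}) ⁻¹' H₀) =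
      p * P.real ((fun η => η \ {s(x, y)}) ⁻¹' (H₀ ∩ openConn x y)) +
        p / (p + q * (1 - p)) * P.real ((fun η => η \ {s(x, y)}) ⁻¹' (H₀ ∩ (openConn x y)ᶜ)) := by
  classical
  set f : BondConfig (Site d) → BondConfig (Site d) := fun ω => ω \ {s(x, y)} with hf
  have hfm : Measurable f := measurable_closeEdges _
  have hU : edgesIn (zdGraph d) {x, y} = {s(x, y)} := edgesIn_zdGraph_pair hxy
  have hKm : MeasurableSet (openConn x y : Set (BondConfig (Site d))) := measurableSet_openConn_holds x y
  set p' := p / (p + q * (1 - p)) with hp'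
  -- `{ω ∖ e ∈ H₀}` is an outside event of the region `{x, y}`
  have hHo : MeasurableSet[outsideEvents d {x, y}] (f ⁻¹' H₀) := by
    refine measurableSet_cylinderEvents_of_determinedBy (hH₀.preimage hfm) ?_
    rw [hU, Finset.coe_singleton]
    exact determinedBy_preimage_closeEdges {s(x, y)} H₀
  -- the cylinder `{e open}` of the region `{x, y}`
  have hJ : cylEvent (edgesIn (zdGraph d) {x, y}) (edgesIn (zdGraph d) {x, y}) =
      {ω : BondConfig (Site d) | s(x, y) ∈ ω} := by
    rw [cylEvent_eq_setOf_subset (Finset.Subset.refl _), hU, Finset.coe_singleton]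
    ext ω
    exact Set.singleton_subset_iff
  have hcyl := real_cylEvent_inter_eq_setIntegral_of_lintegral_rcCondLaw_eq hp hq {x, y} h
    (Finset.Subset.refl _) hHo
  rw [hJ] at hcyl
  rw [hcyl]
  -- integrate the one-edge kernel over `{ω ∖ e ∈ H₀}`
  have hker : ∀ ξ, rcCondProb p q {x, y} ξ (edgesIn (zdGraph d) {x, y}) =
      ((f ⁻¹' openConn x y).indicator (fun _ => p) + (f ⁻¹' (openConn x y)ᶜ).indicator (fun _ => p')) ξ := by
    intro ξ
    rw [hU, rcCondProb_pair_singleton hp hq hxy ξ]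
    by_cases hR : (openGraph (ξ \ {s(x, y)})).Reachable x y
    · have hmem : ξ ∈ f ⁻¹' openConn x y := hR
      have hmem' : ξ ∉ f ⁻¹' (openConn x y)ᶜ := fun h => h hmem
      rw [if_pos hR, Pi.add_apply, Set.indicator_of_mem hmem, Set.indicator_of_notMem hmem', add_zero]
    · have hmem : ξ ∉ f ⁻¹' openConn x y := hR
      have hmem' : ξ ∈ f ⁻¹' (openConn x y)ᶜ := hmem
      rw [if_neg hR, Pi.add_apply, Set.indicator_of_notMem hmem, Set.indicator_of_mem hmem', zero_add]
  have hI1 : IntegrableOn ((f ⁻¹' openConn x y).indicator fun _ => p) (f ⁻¹' H₀) P :=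
    ((integrable_const p).indicator (hKm.preimage hfm)).integrableOn
  have hI2 : IntegrableOn ((f ⁻¹' (openConn x y)ᶜ).indicator fun _ => p') (f ⁻¹' H₀) P :=
    ((integrable_const p').indicator (hKm.compl.preimage hfm)).integrableOn
  simp_rw [hker, Pi.add_apply]
  rw [integral_add hI1 hI2, setIntegral_indicator (hKm.preimage hfm),
    setIntegral_indicator (hKm.compl.preimage hfm), setIntegral_const, setIntegral_const, smul_eq_mul,
    smul_eq_mul, Set.preimage_inter, Set.preimage_inter, Set.preimage_compl, Set.inter_comm (f ⁻¹' H₀),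
    Set.inter_comm (f ⁻¹' H₀)]
  ring

/-- **Grimmett 2006, Prop. (4.37)(a)**: a DLR random-cluster measure `P ∈ R_{p,q}` (`0 ≤ p ≤ 1`, `q > 0`) has
the one-edge conditional probabilities (4.38): for every lattice edge `e = ⟨x,y⟩` and every measurable `H₀`,
`P({e open} ∩ {ω ∖ e ∈ H₀}) = p · P({ω ∖ e ∈ H₀ ∩ K}) + p/(p + q(1-p)) · P({ω ∖ e ∈ H₀ ∖ K})`, `K = {x ↔ y}`,
i.e. `P(J_e | 𝒯_e) = p` on `K_e` and `= p/(p + q(1-p))` off `K_e`. [cite: Grimmett2006, Prop. (4.37)(a) eq. (4.38)] -/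
theorem IsDLRRandomCluster.real_edgeOpen_inter_preimage_eq (hP : IsDLRRandomCluster d p q P)
    (hp : p ∈ Set.Icc (0 : ℝ) 1) (hq : 0 < q) (hxy : (zdGraph d).Adj x y) {H₀ : Set (BondConfig (Site d))}
    (hH₀ : MeasurableSet H₀) :
    P.real ({ω | s(x, y) ∈ ω} ∩ (fun η => η \ {s(x, y)}) ⁻¹' H₀) =
      p * P.real ((fun η => η \ {s(x, y)}) ⁻¹' (H₀ ∩ openConn x y)) +
        p / (p + q * (1 - p)) * P.real ((fun η => η \ {s(x, y)}) ⁻¹' (H₀ ∩ (openConn x y)ᶜ)) := by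
  haveI := hP.isProbabilityMeasure
  exact real_edgeOpen_inter_preimage_eq_of_lintegral_rcCondLaw_pair_eq hp hq hxy
    (fun A hA => hP.lintegral_rcCondLaw_eq {x, y} hA) hH₀

end OneEdge

section DLR

variable (d) in
/-- **Grimmett 2006, Prop. (4.37)(b)**: a probability measure `P` on `Ω` with the one-edge conditional
probabilities (4.38) for every lattice edge — `P({e open} ∩ {ω ∖ e ∈ H₀}) = p · P({ω ∖ e ∈ H₀ ∩ K_e}) +
p/(p + q(1-p)) · P({ω ∖ e ∈ H₀ ∖ K_e})` for all measurable `H₀` — is a DLR random-cluster measure, `P ∈ R_{p,q}`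
(Def. (4.29), `IsDLRRandomCluster`), `0 ≤ p ≤ 1`, `q > 0`. [cite: Grimmett2006, Prop. (4.37)(b) eq. (4.38)] -/
theorem isDLRRandomCluster_of_oneEdge [IsProbabilityMeasure P] (hp : p ∈ Set.Icc (0 : ℝ) 1) (hq : 0 < q)
    (hE : ∀ ⦃x y : Site d⦄, (zdGraph d).Adj x y → ∀ ⦃H₀ : Set (BondConfig (Site d))⦄, MeasurableSet H₀ →
      P.real ({ω | s(x, y) ∈ ω} ∩ (fun η => η \ {s(x, y)}) ⁻¹' H₀) =
        p * P.real ((fun η => η \ {s(x, y)}) ⁻¹' (H₀ ∩ openConn x y)) +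
          p / (p + q * (1 - p)) * P.real ((fun η => η \ {s(x, y)}) ⁻¹' (H₀ ∩ (openConn x y)ᶜ))) :
    IsDLRRandomCluster d p q P where
  isProbabilityMeasure := inferInstance
  lintegral_rcCondLaw_eq Λ _ hA :=
    lintegral_rcCondLaw_eq_of_forall_real_cylEvent_inter_eq hp hq Λ
      (fun _ hη _ hH => real_cylEvent_inter_eq_setIntegral_of_oneEdge hp hq hE Λ hη hH) hA

variable (d) in
/-- **Grimmett 2006, Prop. (4.37)(a)⇔(b): the DLR random-cluster measures are exactly the probability measures
with the one-edge conditional probabilities (4.38)** (`0 ≤ p ≤ 1`, `q > 0`). [cite: Grimmett2006, Prop. (4.37)(a)(b) eq. (4.38)] -/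
theorem isDLRRandomCluster_iff_oneEdge [IsProbabilityMeasure P] (hp : p ∈ Set.Icc (0 : ℝ) 1) (hq : 0 < q) :
    IsDLRRandomCluster d p q P ↔
      ∀ ⦃x y : Site d⦄, (zdGraph d).Adj x y → ∀ ⦃H₀ : Set (BondConfig (Site d))⦄, MeasurableSet H₀ →
        P.real ({ω | s(x, y) ∈ ω} ∩ (fun η => η \ {s(x, y)}) ⁻¹' H₀) =
          p * P.real ((fun η => η \ {s(x, y)}) ⁻¹' (H₀ ∩ openConn x y)) +
            p / (p + q * (1 - p)) * P.real ((fun η => η \ {s(x, y)}) ⁻¹' (H₀ ∩ (openConn x y)ᶜ)) :=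
  ⟨fun hP _ _ hxy _ hH₀ => hP.real_edgeOpen_inter_preimage_eq hp hq hxy hH₀,
    fun hE => isDLRRandomCluster_of_oneEdge d hp hq hE⟩

variable (d) in
/-- **The DLR equation for the one-edge regions implies the DLR equation for all finite regions**: a probability
measure with `∫ φ^ξ_{{x,y},p,q}(A) P(dξ) = P(A)` for every lattice edge `⟨x,y⟩` and every event `A` belongs to
`R_{p,q}` (`0 ≤ p ≤ 1`, `q > 0`). [cite: Grimmett2006, Prop. (4.37)(b), Def. (4.29)] -/
theorem isDLRRandomCluster_of_pairs [IsProbabilityMeasure P] (hp : p ∈ Set.Icc (0 : ℝ) 1) (hq : 0 < q)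
    (h : ∀ ⦃x y : Site d⦄, (zdGraph d).Adj x y → ∀ ⦃A : Set (BondConfig (Site d))⦄, MeasurableSet A →
      ∫⁻ ξ, rcCondLaw p q {x, y} ξ A ∂P = P A) :
    IsDLRRandomCluster d p q P :=
  isDLRRandomCluster_of_oneEdge d hp hq fun _ _ hxy _ hH₀ =>
    real_edgeOpen_inter_preimage_eq_of_lintegral_rcCondLaw_pair_eq hp hq hxy (h hxy) hH₀

variable (d) in
/-- `P ∈ R_{p,q}` iff the DLR equation holds for the one-edge regions `{x, y}` (`0 ≤ p ≤ 1`, `q > 0`).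
[cite: Grimmett2006, Prop. (4.37)(a)(b), Def. (4.29)] -/
theorem isDLRRandomCluster_iff_pairs [IsProbabilityMeasure P] (hp : p ∈ Set.Icc (0 : ℝ) 1) (hq : 0 < q) :
    IsDLRRandomCluster d p q P ↔
      ∀ ⦃x y : Site d⦄, (zdGraph d).Adj x y → ∀ ⦃A : Set (BondConfig (Site d))⦄, MeasurableSet A →
        ∫⁻ ξ, rcCondLaw p q {x, y} ξ A ∂P = P A :=
  ⟨fun hP _ _ _ _ hA => hP.lintegral_rcCondLaw_eq _ hA, fun h => isDLRRandomCluster_of_pairs d hp hq h⟩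

end DLR

end Summit.CriticalPhenomena.PercolationContinuityZ3.Theorems.FK

end
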